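/-
Copyright (c) 2026. Released under the Apache 2.0 license.
-/
import Literature.NumberTheory.Automorphic.ShimuraCurveRibetTakahashiOptimalProofs
import Literature.NumberTheory.EllipticCurves.ManinConstantDeuringTwistProofs
import HarnessLib

/-!
# `exists_optimal_modularParametrizationData` from Modularity alone

[Proofs] Theorems only. The named fact
`Literature.NumberTheory.Automorphic.exists_optimal_modularParametrizationData` (the optimal
modular parametrization datum of Pasten–Shimura, `ShimuraCurveRibetTakahashi.lean`) was shown in
`ShimuraCurveRibetTakahashiOptimalProofs` to be EQUIVALENT to the conjunction of two named facts:
Modularity (`Literature.NumberTheory.EllipticCurves.ModularForms.exists_isNewformOf`) and Edixhoven's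
integrality of the Manin constant
(`Literature.NumberTheory.EllipticCurves.edixhoven_int_of_neronLattice_eq_smul_periodLattice`).
The latter is now a THEOREM (`edixhoven_int_of_neronLattice_eq_smul_periodLattice_holds`,
`ManinConstantDeuringTwistProofs`), so the fact follows from — and is equivalent to — Modularity
alone:

* `exists_optimal_modularParametrizationData_of_modularity`,
* `exists_optimal_modularParametrizationData_iff_modularity`.

Consequently the fact's unconditional content is PER CURVE — the optimal datum of every MODULAR
elliptic curve over `ℚ`, with no other input (Pasten–Shimura §2, p. 12: "the modularity theorem
associates to `E` a unique newform … optimal quotient … isogenous to `E`"):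

* `nonempty_modularParametrizationData_of_isNewformOf` — a parametrisation datum of `W` at level
  `N` from its newform `f ∈ S₂(Γ₀(N))` alone;
* `exists_optimal_modularParametrizationData_of_isNewformOf` (and `…'` with `D₀.f = f`),
  `exists_optimal_modularParametrizationData_of_isModular` — the conclusion of the fact for one
  globally minimal `W` from `IsNewformOf W f`, resp. from `BCDT.IsModular W`;
* `exists_optimal_modularParametrizationData_iff_forall_isModular`;
* `exists_optimal_modularParametrizationData_of_CDT712` (`27 ∤ N_W`) and
  `…_of_CDT712_of_squarefree` (square-free conductor, i.e. semistable curves such as Frey curves)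
  — for these the modularity input is Conrad–Diamond–Taylor 1999, Thm. 7.1.2 (Wiles, Taylor–Wiles,
  Diamond, CDT), the tree's named fact `BCDT.CDT_theorem_7_1_2`, not BCDT's Theorem A.

## References
* [ConradDiamondTaylor1999] B. Conrad, F. Diamond, R. Taylor, *Modularity of certain potentially
  Barsotti–Tate Galois representations*, J. Amer. Math. Soc. 12 (1999), Thm. 7.1.2 (p. 551).
* [PastenShimura2024] H. Pasten, *Shimura curves and the abc conjecture*, J. Number Theory 254
  (2024), §10.
* [EdixhovenManin1991] B. Edixhoven, *On the Manin constants of modular elliptic curves*,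
  Progr. Math. 89 (1991), Prop. 2.
* [BCDTJAMS2001] C. Breuil, B. Conrad, F. Diamond, R. Taylor, *On the modularity of elliptic
  curves over `ℚ`*, J. Amer. Math. Soc. 14 (2001), Thm. A.
-/

noncomputable section

namespace Literature.NumberTheory.Automorphic

open Literature.NumberTheory.EllipticCurves Literature.NumberTheory.EllipticCurves.ModularForms

/-- **The optimal modular parametrization datum exists for every elliptic curve over `ℚ`, given
Modularity** — Edixhoven's integrality being a theorem of the tree.
[cite: PastenShimura2024, §10.1 (p. 33)] [cite: EdixhovenManin1991, Prop. 2] -/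
theorem exists_optimal_modularParametrizationData_of_modularity (h : exists_isNewformOf) :
    exists_optimal_modularParametrizationData :=
  exists_optimal_modularParametrizationData_of_exists_isNewformOf_of_edixhovenFact h
    edixhoven_int_of_neronLattice_eq_smul_periodLattice_holds

/-- **The fact is EQUIVALENT to Modularity** (`exists_isNewformOf`): necessity is
`exists_isNewformOf_of_exists_optimal_modularParametrizationData`.
[cite: PastenShimura2024, §10.1 (p. 33)] [cite: BCDTJAMS2001, Thm. A] -/
theorem exists_optimal_modularParametrizationData_iff_modularity :
    exists_optimal_modularParametrizationData ↔ exists_isNewformOf :=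
  ⟨exists_isNewformOf_of_exists_optimal_modularParametrizationData,
    exists_optimal_modularParametrizationData_of_modularity⟩

/-! ### Per curve: the optimal datum of a modular elliptic curve, unconditionally
-/

section PerCurve

open scoped MatrixGroups ModularForm
open CongruenceSubgroup

/-!
Since the fact is equivalent to the Modularity theorem, its unconditional content is PER CURVE:
the optimal datum exists for every elliptic curve `E/ℚ` that is modular — i.e. has a newform of
level `N_E` (`IsNewformOf`; equivalently `BCDT.IsModular E`, Breuil–Conrad–Diamond–Taylor 2001,
Introduction, condition (2)) — with no further input: Edixhoven's integrality
(`edixhoven_int_of_neronLattice_eq_smul_periodLattice_holds`), the non-zero integral multiplier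
`c Λ_f ⊆ Λ_E` (`IsNewformOf.exists_maninConstant_ne_zero_holds`), the Néron-type period pair, the
uniformisation and the degree are theorems of the tree. This is the form in which Pasten introduces
the datum ([PastenShimura2024, §2 p. 12]: "the modularity theorem associates to `E` a unique
newform `f` … optimal quotient … isogenous to `E`"), so a user needing the datum of ONE curve (e.g.
a Frey curve) needs only the modularity of that curve. -/

/-- **A modular parametrisation datum at level `N` from the newform alone, per curve.** If
`f ∈ S₂(Γ₀(N))` is the newform of the elliptic curve `W/ℚ` (`IsNewformOf W f`), then `W` admits a
`ModularParametrizationData W N`: the Néron-type period pair is `exists_isNeronLatticeOf_holds`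
(Silverman AEC VI.5.1), the non-zero integer `c` with `c Λ_f ⊆ Λ_E` is
`IsNewformOf.exists_maninConstant_ne_zero_holds` (BCDT 2001, p. 845, "(2) ⇒ (6)"), the
uniformisation `ℂ →+ E(ℂ)` is `IsNeronLatticeOf.exists_uniformize_holds` (AEC VI.3.6 (b)) and the
degree of `Γ₀(N)τ ↦ c · 2πi ∫_{i∞}^τ f (mod Λ_E)` is `exists_modularDegree_holds`, transported to
`E(ℂ)` along `ℂ/Λ_E ≃ E(ℂ)` (`finite_setOf_card_fiberOrbits_ne_iff`) — the per-curve form of the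
tree's `nonempty_modularParametrizationData_of` (same construction as
`ModularParametrizationData.nonempty_of_isNewformOf` of `HeegnerPointsModularityProofs`, which takes
`L` and `c` as arguments). [cite: BCDTJAMS2001, Thm. A with (6) of p. 845] -/
theorem nonempty_modularParametrizationData_of_isNewformOf {N : ℕ} [NeZero N]
    {W : WeierstrassCurve ℚ} [W.IsElliptic] {f : CuspForm (Gamma0 N) 2} (hf : IsNewformOf W f) :
    Nonempty (ModularParametrizationData W N) := by
  haveI : (W.baseChange ℂ).IsElliptic := by rw [WeierstrassCurve.baseChange]; infer_instance
  obtain ⟨L, hL⟩ := exists_isNeronLatticeOf_holds (W.baseChange ℂ)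
  obtain ⟨c, hc0, hc⟩ := IsNewformOf.exists_maninConstant_ne_zero_holds hf hL
  obtain ⟨u, hker, hsurj, hspec⟩ := IsNeronLatticeOf.exists_uniformize_holds hL
  obtain ⟨d, hd, hfin⟩ := exists_modularDegree_holds hf.1.ne_zero (L := L) (c := (c : ℂ))
    (Int.cast_ne_zero.mpr hc0) hc
  -- transport the exceptional set along `ℂ/Λ_E ≃ E(ℂ)`
  have hker' : L.lattice.toAddSubgroup = u.ker :=
    SetLike.coe_injective (by rw [Submodule.coe_toAddSubgroup, hker])
  let e : ℂ ⧸ L.lattice.toAddSubgroup ≃+ (W.baseChange ℂ).toAffine.Point :=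
    QuotientAddGroup.liftEquiv L.lattice.toAddSubgroup hsurj hker'
  have he : ∀ x : ℂ, e.toEquiv (x : ℂ ⧸ L.lattice.toAddSubgroup) = u x := fun _ ↦ rfl
  have key := (finite_setOf_card_fiberOrbits_ne_iff e.toEquiv
    (fun τ : UpperHalfPlane ↦
      (((c : ℂ) * eichlerIntegral f τ : ℂ) : ℂ ⧸ L.lattice.toAddSubgroup)) d).mpr hfin
  simp only [he] at key
  exact ⟨{ f := f
           isNewformOf := hf
           L := L
           isNeronLattice := hL
           uniformize := u
           ker_uniformize := hker
           uniformize_surjective := hsurj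
           uniformize_spec := hspec
           c := c
           smul_periodLattice_le := hc
           deg := d
           deg_pos := hd
           deg_spec := key }⟩

/-- **The optimal datum of a modular elliptic curve, unconditionally per curve** (Pasten–Shimura,
§2 and §10.1). Let `W/ℚ` be a globally minimal elliptic curve of conductor `N` and `f ∈ S₂(Γ₀(N))`
its newform (`IsNewformOf W f` — the modularity of THIS curve, the only input). Then there are a
globally minimal `W₀/ℚ`, isogenous to `W` over `ℚ`, and a datum `D₀` of `W₀` at level `N` whose
newform is that of `W` and whose modular degree is least among all data (of any model of any curve)
with the same newform — verbatim the conclusion of `exists_optimal_modularParametrizationData` for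
`W`. Proof: the datum of `W` is `nonempty_modularParametrizationData_of_isNewformOf hf`, and the
relative cut `exists_optimal_relative_of_edixhovenFact` is fed with the THEOREM
`edixhoven_int_of_neronLattice_eq_smul_periodLattice_holds` (Edixhoven 1991, Prop. 2).
[cite: PastenShimura2024, §2 (p. 12) and §10.1 (p. 33)] [cite: EdixhovenManin1991, Prop. 2] -/
theorem exists_optimal_modularParametrizationData_of_isNewformOf (N : ℕ) [NeZero N]
    (W : WeierstrassCurve ℚ) [W.IsElliptic] [W.IsGloballyMinimal] (hN : W.conductorNorm ℤ = N)
    {f : CuspForm (Gamma0 N) 2} (hf : IsNewformOf W f) :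
    ∃ (W₀ : WeierstrassCurve ℚ) (_ : W₀.IsElliptic) (_ : W₀.IsGloballyMinimal)
      (D₀ : ModularParametrizationData W₀ N),
      IsNewformOf W D₀.f ∧ W.IsIsogenous W₀ ∧
        ∀ (W₂ : WeierstrassCurve ℚ) [W₂.IsElliptic] (D₂ : ModularParametrizationData W₂ N),
          D₂.f = D₀.f → D₀.modularDegree ≤ D₂.modularDegree :=
  exists_optimal_relative_of_edixhovenFact edixhoven_int_of_neronLattice_eq_smul_periodLattice_holds
    N W hN (nonempty_modularParametrizationData_of_isNewformOf hf)

/-- **Same, with the newform of the optimal datum identified**: in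
`exists_optimal_modularParametrizationData_of_isNewformOf` one has `D₀.f = f`, by the `q`-expansion
principle (`IsNewformOf.unique`: both are newforms of `W` at level `N`).
[cite: PastenShimura2024, §2 (p. 12) and §10.1 (p. 33)] -/
theorem exists_optimal_modularParametrizationData_of_isNewformOf' (N : ℕ) [NeZero N]
    (W : WeierstrassCurve ℚ) [W.IsElliptic] [W.IsGloballyMinimal] (hN : W.conductorNorm ℤ = N)
    {f : CuspForm (Gamma0 N) 2} (hf : IsNewformOf W f) :
    ∃ (W₀ : WeierstrassCurve ℚ) (_ : W₀.IsElliptic) (_ : W₀.IsGloballyMinimal)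
      (D₀ : ModularParametrizationData W₀ N),
      D₀.f = f ∧ W.IsIsogenous W₀ ∧
        ∀ (W₂ : WeierstrassCurve ℚ) [W₂.IsElliptic] (D₂ : ModularParametrizationData W₂ N),
          D₂.f = f → D₀.modularDegree ≤ D₂.modularDegree := by
  obtain ⟨W₀, h₀, h₀', D₀, hD₀, hiso, hmin⟩ :=
    exists_optimal_modularParametrizationData_of_isNewformOf N W hN hf
  obtain rfl : D₀.f = f := hD₀.unique hf
  exact ⟨W₀, h₀, h₀', D₀, rfl, hiso, hmin⟩

/-- **The optimal datum from `BCDT.IsModular W`** (Breuil–Conrad–Diamond–Taylor 2001,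
Introduction, condition (2), the tree's per-curve normal form of Theorem A: a newform of level
`N_E` attached to `W`): the conclusion of `exists_optimal_modularParametrizationData` for the
globally minimal curve `W` at its conductor. [cite: PastenShimura2024, §2 (p. 12) and §10.1 (p. 33)]
[cite: BCDTJAMS2001, Introduction, condition (2)] -/
theorem exists_optimal_modularParametrizationData_of_isModular (W : WeierstrassCurve ℚ)
    [W.IsElliptic] [W.IsGloballyMinimal] [NeZero (W.conductorNorm ℤ)] (h : BCDT.IsModular W) :
    ∃ (W₀ : WeierstrassCurve ℚ) (_ : W₀.IsElliptic) (_ : W₀.IsGloballyMinimal)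
      (D₀ : ModularParametrizationData W₀ (W.conductorNorm ℤ)),
      IsNewformOf W D₀.f ∧ W.IsIsogenous W₀ ∧
        ∀ (W₂ : WeierstrassCurve ℚ) [W₂.IsElliptic]
          (D₂ : ModularParametrizationData W₂ (W.conductorNorm ℤ)),
          D₂.f = D₀.f → D₀.modularDegree ≤ D₂.modularDegree := by
  obtain ⟨f, hf⟩ := h
  exact exists_optimal_modularParametrizationData_of_isNewformOf _ W rfl hf

/-- **The fact, curve by curve**: `exists_optimal_modularParametrizationData` holds iff every
elliptic curve over `ℚ` is modular in the sense of BCDT's condition (2) (`∀ W, BCDT.IsModular W`,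
which is Theorem A = `exists_isNewformOf` by `BCDT.exists_isNewformOf_iff`).
[cite: BCDTJAMS2001, Thm. A] [cite: PastenShimura2024, §10.1 (p. 33)] -/
theorem exists_optimal_modularParametrizationData_iff_forall_isModular :
    exists_optimal_modularParametrizationData ↔
      ∀ (W : WeierstrassCurve ℚ) [W.IsElliptic] [NeZero (W.conductorNorm ℤ)], BCDT.IsModular W :=
  exists_optimal_modularParametrizationData_iff_modularity.trans BCDT.exists_isNewformOf_iff

/-! ### Conductor not divisible by `27` (in particular square-free conductor): CDT Thm. 7.1.2 suffices

For the curves to which the datum is applied in practice — semistable curves, e.g. Frey curves,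
whose conductor is square-free — the modularity input is not Breuil–Conrad–Diamond–Taylor's
Theorem A but the earlier theorem of Conrad–Diamond–Taylor 1999 (Thm. 7.1.2 = the Theorem of their
Introduction, resting on Wiles 1995, Taylor–Wiles 1995 and Diamond 1996): every `E/ℚ` whose
conductor is not divisible by `27` is modular — the tree's named fact `BCDT.CDT_theorem_7_1_2`. -/

/-- **The optimal datum of a curve with `27 ∤ N_E`, from CDT 1999 Thm. 7.1.2 alone**
(Conrad–Diamond–Taylor, JAMS 12 (1999), Thm. 7.1.2, p. 551: "every elliptic curve over `ℚ` of
conductor not divisible by `27` is modular", the tree's `BCDT.CDT_theorem_7_1_2`): the conclusion of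
`exists_optimal_modularParametrizationData` for a globally minimal `W` with `27 ∤ N_W`
(`exists_optimal_modularParametrizationData_of_isModular`).
[cite: ConradDiamondTaylor1999, Thm. 7.1.2 (p. 551)] [cite: PastenShimura2024, §2 (p. 12) and §10.1 (p. 33)] -/
theorem exists_optimal_modularParametrizationData_of_CDT712 (h712 : BCDT.CDT_theorem_7_1_2)
    (W : WeierstrassCurve ℚ) [W.IsElliptic] [W.IsGloballyMinimal] [NeZero (W.conductorNorm ℤ)]
    (h27 : ¬ 27 ∣ W.conductorNorm ℤ) :
    ∃ (W₀ : WeierstrassCurve ℚ) (_ : W₀.IsElliptic) (_ : W₀.IsGloballyMinimal)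
      (D₀ : ModularParametrizationData W₀ (W.conductorNorm ℤ)),
      IsNewformOf W D₀.f ∧ W.IsIsogenous W₀ ∧
        ∀ (W₂ : WeierstrassCurve ℚ) [W₂.IsElliptic]
          (D₂ : ModularParametrizationData W₂ (W.conductorNorm ℤ)),
          D₂.f = D₀.f → D₀.modularDegree ≤ D₂.modularDegree :=
  exists_optimal_modularParametrizationData_of_isModular W (h712 W h27)

/-- **The optimal datum of a curve of square-free conductor** (i.e. of a semistable curve — for
elliptic `W/ℚ`, `W.IsSemistable ℤ ↔ Squarefree N_W` is the tree's
`WeierstrassCurve.isSemistable_iff_squarefree_conductorNorm`; e.g. a Frey curve) **from CDT 1999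
Thm. 7.1.2 alone**: `9 ∣ 27`, so a square-free conductor is not divisible by `27`
(`exists_optimal_modularParametrizationData_of_CDT712`). For semistable curves Thm. 7.1.2 is already
Wiles 1995, Thm. 0.4 with Taylor–Wiles 1995. [cite: ConradDiamondTaylor1999, Thm. 7.1.2 (p. 551)]
[cite: Wiles1995] [cite: PastenShimura2024, §2 (p. 12) and §10.1 (p. 33)] -/
theorem exists_optimal_modularParametrizationData_of_CDT712_of_squarefree
    (h712 : BCDT.CDT_theorem_7_1_2) (W : WeierstrassCurve ℚ) [W.IsElliptic] [W.IsGloballyMinimal]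
    [NeZero (W.conductorNorm ℤ)] (hsq : Squarefree (W.conductorNorm ℤ)) :
    ∃ (W₀ : WeierstrassCurve ℚ) (_ : W₀.IsElliptic) (_ : W₀.IsGloballyMinimal)
      (D₀ : ModularParametrizationData W₀ (W.conductorNorm ℤ)),
      IsNewformOf W D₀.f ∧ W.IsIsogenous W₀ ∧
        ∀ (W₂ : WeierstrassCurve ℚ) [W₂.IsElliptic]
          (D₂ : ModularParametrizationData W₂ (W.conductorNorm ℤ)),
          D₂.f = D₀.f → D₀.modularDegree ≤ D₂.modularDegree :=
  exists_optimal_modularParametrizationData_of_CDT712 h712 W fun h27 ↦ by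
    -- `3 * 3 ∣ 27 ∣ N_W` would make `3` a unit
    have h9 : 3 * 3 ∣ W.conductorNorm ℤ := dvd_trans ⟨3, by norm_num⟩ h27
    exact absurd (Nat.isUnit_iff.mp (hsq 3 h9)) (by norm_num)

end PerCurve

end Literature.NumberTheory.Automorphic

end
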